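import Mathlib
import Literature.Analysis.FluidPDE.Tao2016AveragedNS.ShiftSetCascadeFlows
import Literature.Analysis.FluidPDE.Tao2016AveragedNS.ShiftSetCascadeFlux
import Summits.NavierStokesRegularity.NavierStokesRegularity.Theorems.TaoLadderRungTwoFlatCertificateGlueCertificateE3On
import Summits.NavierStokesRegularity.NavierStokesRegularity.Theorems.TaoLadderRungTwoFlatCertificateGlueCheckerLandSOn
import HarnessLib

/-!
# Certificate glue on a shift set `𝕊`, XXXVIII-h: THE FINAL ASSEMBLIES OVER ABSTRACT STEP FACTS — glue XXXVI-c / XXXVII-b (`stub_rung_quarter_of_certificateL` / `…E3`)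
  with the per-step Boolean hypothesis replaced by `StepFacts` (glue XXXVIII-g); every other hypothesis and the conclusion (the registered stub `stub_rung_quarter`,
  ε₀ = ¼) VERBATIM. Any step checker with a `stepFacts_of_…` lemma (today `checkStepG`, `checkStepGJ`) instantiates `hs` pointwise (helper for item
  stmt-NavierStokesRegularity-22987 `FlatGapCertificatesV2` (crux K_A♭ of route TaoLadderRungTwoFlat); cell harvest/h2-tao-ladder, p1 g18)

HONEST FRAMING: Tao-type MODEL lattice `T♭(½)` on `S♭` at `ε₀ = ¼`; soundness of the certificate FORMAT — NO certificate instance exists in the tree, nothing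
is certified here, no stub is closed by this file, nothing here is a statement about the Navier–Stokes equations.
-/

noncomputable section

-- the sub-problem namespace repeats the summit name by design (D-0017)
set_option linter.dupNamespace false

namespace Summit.NavierStokesRegularity.NavierStokesRegularity.Theorems

open Set Finset Literature.Analysis.FluidPDE Literature.Analysis.FluidPDE.TaoCascade
open Summit.NavierStokesRegularity.NavierStokesRegularity.Theorems.TaylorModelCert

namespace CertificateGlueOn

/-! ### The final assembly, format L, abstract step facts -/

/-- **THE REGISTERED STUB `stub_rung_quarter` FROM A CHECKED CERTIFICATE WITH PER-BRANCH GAUGES, READOUT-L AND A BOX-FAMILY CORE**: glue IX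
`stub_rung_quarter_of_checks` with `htrap` := glue XXXVIII-g `htrap_of_stepFactsP`, `hland` := glue XXXVIII-g `hland_of_stepFactsL` (readout by `checkReadoutL`
against the box of the assigned reference index `tgt bb j`), the core `Z := coreBoxFam Cs cen chw`, and `hcore` / `hdatum` / `hcoreTop` / `hinside` / `hcover`
from `checkRefBox` (box `l` covered by the start box of branch `start l`, in that branch's gauge) / `checkDatumBox`.
[cite: Tao2016AveragedNS, §6.3–6.4 Props. 6.4–6.5 (statement shape of a renormalisation certificate); route TaoLadderRungTwoFlat, crux K_A♭, stub_rung_quarter, certificate format L] -/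
theorem stub_rung_quarter_of_certificateLS
    -- window, datum
    {Kb Ka : ℤ} (hKb : 0 ≤ Kb) (hKa : 4 ≤ Ka) {x0q : Fin 2 → ℚ} (hx0 : x0q 0 ≠ 0)
    -- glue IX's reals, tied to rationals
    {M w : ℤ → ℝ} {Mq wq : ℤ → ℚ} (hM : ∀ k, M k = (Mq k : ℝ)) (hwq : ∀ k, w k = (wq k : ℝ))
    {r ρ θ₀ θ c₀ c σ : ℝ} {rq ρq c₀q cq σq : ℚ} {θn θd : ℕ} (hrq : r = (rq : ℝ)) (hρq : ρ = (ρq : ℝ))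
    (hθ₀q : θ₀ = (θn : ℝ) / (θd : ℝ)) (hc₀q : c₀ = (c₀q : ℝ)) (hcq : c = (cq : ℝ)) (hσq : σ = (σq : ℝ))
    (hr : 0 < r) (hρ : 0 ≤ ρ) (hρ1 : ρ < 1) (hθ₀ : 0 ≤ θ₀) (hθ₀θ : θ₀ < θ) (hθ : θ ≤ 1 / 2) (hc₀ : 0 < c₀) (hc₀c : c₀ < c) (hσ : 0 < σ)
    {Mmax : ℝ} (hMmax : ∀ k, -Kb ≤ k → k ≤ Ka → M k ≤ Mmax)
    -- the piecewise-Gaussian weight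
    {Cw b : ℝ} (hCw : 1 ≤ Cw) (hb : 1 / 2 ≤ b)
    (hwp : ∀ k : ℤ, 0 ≤ k → w k = Cw * (2 : ℝ) ^ ((k : ℝ) ^ 2 / 2 + b * k)) (hwn : ∀ k : ℤ, k < 0 → w k = Cw)
    -- wake side
    {Zb Zf : ℤ → ℝ} {Cb γ : ℝ} (hCb : 0 < Cb) (hγ0 : 0 ≤ γ) (hγ1 : γ ≤ 1)
    (hZb : ∀ j : ℤ, Zb j = Cb * (1 + (1 / 4 : ℝ)) ^ (-(γ * j)))
    (hZf : ∀ j : ℤ, Zf j = 2 * (Zb j + r / Cw)) (hMZf : M (-Kb) ≤ Zf (-Kb))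
    (checkB₁ : 32 * c * 28 * (1 + (1 / 4 : ℝ)) ^ (2 * γ) *
      ((1 + (1 / 4 : ℝ)) ^ ((5 : ℝ) * ((-Kb - 1 : ℤ) : ℝ) / 2) * (Zb (-Kb - 1) + r / Cw)) ≤ 1)
    (checkB₂ : (1 + (1 / 4 : ℝ)) ^ θ₀ * (Zb (-Kb - 1) + r / Cw +
      32 * c * 28 * (1 + (1 / 4 : ℝ)) ^ (2 * γ) *
        ((1 + (1 / 4 : ℝ)) ^ ((5 : ℝ) * ((-Kb - 1 : ℤ) : ℝ) / 2) * (Zb (-Kb - 1) + r / Cw) ^ 2)) ≤ Zb (-Kb - 1 - 1))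
    -- quiet side
    {ν : ℤ → ℝ} {ν₀ ν₁ ϑ : ℝ}
    (hνKa : ν Ka = ν₀) (hνhi : ∀ K : ℤ, Ka + 1 ≤ K → ν K = ν₁) (hν₀ : 0 ≤ ν₀) (hν₁ : 0 ≤ ν₁)
    (hMν : M Ka ≤ ν₀ * r / w (Ka - 1))
    (checkA₁ : (1 + (1 / 4 : ℝ)) ^ ((5 : ℝ) * ((Ka + 1 : ℤ) : ℝ) / 2) * r * w (Ka + 1 - 1) ≤ ϑ * w (Ka + 1 - 2) ^ 2)
    (checkA₂ : (1 + (1 / 4 : ℝ)) ^ ((5 : ℝ) * ((Ka : ℤ) : ℝ) / 2) *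
      coeffAbsOn (botShifts shiftSetFlat) (mirrorTable (1 / 2) (1 / 2)) * c * (ν₀ * r / w (Ka - 1)) ≤ 1 / 2)
    (checkA₃ : (1 + (1 / 4 : ℝ)) ^ ((5 : ℝ) * ((Ka + 1 : ℤ) : ℝ) / 2) *
      coeffAbsOn (botShifts shiftSetFlat) (mirrorTable (1 / 2) (1 / 2)) * c * (ν₁ * r / w Ka) ≤ 1 / 2)
    (checkA₄ : 2 * (Real.sqrt 2 * Real.sqrt (4 / 3 * (2 : ℕ) * (25 / 32)) / (2 * (1 + (1 / 4 : ℝ)) ^ ((Ka : ℤ) : ℝ)) +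
      coeffAbsOn (botShifts shiftSetFlat) (mirrorTable (1 / 2) (1 / 2)) * c *
        (ϑ / (1 + (1 / 4 : ℝ)) ^ ((5 : ℝ) / 2)) * ν₀ ^ 2) ≤ ν₁)
    (checkA₅ : 2 * (Real.sqrt 2 * Real.sqrt (4 / 3 * (2 : ℕ) * (25 / 32)) / (2 * (1 + (1 / 4 : ℝ)) ^ ((Ka + 1 : ℤ) : ℝ)) +
      coeffAbsOn (botShifts shiftSetFlat) (mirrorTable (1 / 2) (1 / 2)) * c *
        (ϑ / (1 + (1 / 4 : ℝ)) ^ ((5 : ℝ) / 2)) * ν₁ ^ 2) ≤ ν₁)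
    (checkA₆ : ν₁ * (1 + (1 / 4 : ℝ)) ^ θ₀ ≤ ρ)
    -- the envelope values used by the checkers: rational OUTER bounds of the (irrational) envelopes (`Zf(−Kb−1) = 2(Cb(5/4)^{γ(Kb+1)} + r/Cw)`)
    {Eb Et Zx : ℚ} (hEb : Zf (-Kb - 1) ≤ (Eb : ℝ)) (hEt : ν (Ka + 1) * r / w Ka ≤ (Et : ℝ)) (hZx : (Zx : ℝ) ≤ Zb (-Kb - 1))
    -- THE CERTIFICATE: per-branch gauges and tables, branch chains, section records, READOUT-L data, the box family
    {ι : Type*} {ωq : ι → Fin 2 → ℤ → ℚ} (hω : ∀ bb i k, 0 < ωq bb i k)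
    {cB : ι → Fin 2 → ℤ → Fin 2 → Fin 2 → ℤ × ℤ × ℤ → IntervalD}
    (hcoef : ∀ bb, CoefBoxOK shiftsFlat (((1 / 4 : ℚ)) : ℝ) (fun i₁ i₂ i μ => ((mirrorTableQ (1 / 2) (1 / 2) i₁ i₂ i μ : ℚ) : ℝ)) Kb Ka
      (fun i k => (ωq bb i k : ℝ)) (cB bb))
    {prec : ι → ℕ} {Sp Sm : ι → IntervalD} {bD : ι → Dyad} {qz : ι → Array ℤ} {lev : ι → ℚ}
    {rec : ι → ℕ → VRec} {N j₁ j₂ : ι → ℕ} {sr : ι → ℕ → SecRec} {ell : ι → ℕ → Array Dyad}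
    {L : ℕ} {Cs : Fin L → ℚ} {cen chw : Fin L → Array Dyad} {start : Fin L → ι} {tgt : ι → ℕ → Fin L} {l₀ : Fin L}
    (hg : ∀ bb, checkGlobalG 2 Kb Ka (prec bb) shiftsFlat (cB bb) (1 / 4) (Sp bb) (Sm bb) (bD bb) = true)
    (hs : ∀ bb j, j < N bb →
      StepFacts shiftsFlat (1 / 4) (mirrorTableQ (1 / 2) (1 / 2)) Kb Ka (prec bb) (cB bb) (ωq bb) (Sp bb) (Sm bb) Eb Et M (rec bb) j)
    (htr : ∀ bb j, j < N bb → checkTransit 2 Kb Ka (ωq bb) Mq (rec bb j).lo (rec bb j).hi = true)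
    (hcN : ∀ bb, cq ≤ sumHV (rec bb) (N bb))
    (hj : ∀ bb, j₁ bb ≤ j₂ bb) (hjN : ∀ bb, j₂ bb < N bb)
    (hsec : ∀ bb j, j₁ bb ≤ j → j ≤ j₂ bb →
      checkSection 2 Kb Ka (prec bb) shiftsFlat (cB bb) (qz bb) (rec bb j).lo (rec bb j).hi (rec bb j).δ (sr bb j) = true)
    (hread : ∀ bb j, j₁ bb ≤ j → j ≤ j₂ bb →
      checkReadoutL 2 Kb Ka (ωq bb) 0 (1 / 4) σq ρq rq Zx Et θn θd wq (Cs (tgt bb j)) (ell bb j) (cen (tgt bb j)) (chw (tgt bb j))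
        (xsArr (2 * winLen Kb Ka) (qz bb) (sr bb j) (rec bb j).x (lev bb)) (csArr (2 * winLen Kb Ka) (qz bb) (sr bb j) (rec bb j).C) (rec bb j).r
        (esArr (2 * winLen Kb Ka) (qz bb) (sr bb j) (rec bb j).E (rec bb j).h) = true)
    (hbefore : ∀ bb, checkSecBelow (2 * winLen Kb Ka) (qz bb) (rec bb (j₁ bb)) (lev bb) = true)
    (hafter : ∀ bb, checkSecAbove (2 * winLen Kb Ka) (qz bb) (rec bb (j₂ bb + 1)) (lev bb) = true)
    (hpos : ∀ bb, 0 < sumHV (rec bb) (j₁ bb)) (hc₀N : ∀ bb, sumHV (rec bb) (j₂ bb + 1) ≤ c₀q)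
    (hid : ∀ bb, checkIdFrame (2 * winLen Kb Ka) (rec bb 0).C = true) (hE : ∀ bb, checkNonneg (2 * winLen Kb Ka) (rec bb 0).E = true)
    (hrefs : ∀ l, checkRefBox Kb Ka (ωq (start l)) wq Mq rq (Cs l) (cen l) (chw l) (rec (start l) 0).x (rec (start l) 0).r = true)
    (hdat : checkDatumBox Kb Ka x0q (Cs l₀) (cen l₀) (chw l₀) = true) :
    ∃ (σ : ℝ) (X₀ : Fin 2 → ℝ) (Z : Set (Fin 2 → ℤ → ℝ)) (w : ℤ → ℝ) (r ρ θ₀ θ c₀ c : ℝ) (env₀ : ℤ → ℝ),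
      X₀ 0 ≠ 0 ∧
        GapData₂On shiftSetFlat σ (1 / 4) (0 : Fin 2) (mirrorTable (1 / 2) (1 / 2)) X₀ Z w r ρ θ₀ θ c₀ c env₀ ∧
          TailThin (1 / 4) w r ∧
            ∃ (Cw b : ℝ), 1 ≤ Cw ∧ 1 / 2 ≤ b ∧ ∀ k : ℤ, 0 ≤ k → w k = Cw * (2 : ℝ) ^ ((k : ℝ) ^ 2 / 2 + b * k) := by
  -- tie the reals to the rationals
  have hMfun : M = fun k => (Mq k : ℝ) := funext hM
  have hwfun : w = fun k => (wq k : ℝ) := funext hwq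
  subst hMfun hwfun hrq hρq hθ₀q hc₀q hcq hσq
  have hKa1 : 1 ≤ Ka := by omega
  have hq : (0 : ℝ) < 1 + ((1 / 4 : ℚ) : ℝ) := by push_cast; norm_num
  have hqe : ((1 / 4 : ℚ) : ℝ) = (1 / 4 : ℝ) := by push_cast; ring
  have h𝕊 : IsNearestNeighbourSet shiftsFlat.toFinset := by rw [shiftsFlat_toFinset]; exact isNearestNeighbourSet_shiftSetFlat
  -- the datum and the core
  set X₀ : Fin 2 → ℝ := fun i => (x0q i : ℝ) with hX₀def
  have hX₀ : X₀ 0 ≠ 0 := by simp only [hX₀def]; exact_mod_cast hx0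
  set Core : (Fin 2 → ℤ → ℝ) → Prop := coreBoxFam Kb Ka Cs cen chw with hCore
  have hcore : ∀ z z' : Fin 2 → ℤ → ℝ, (∀ i k, -Kb ≤ k → k ≤ Ka → z i k = z' i k) → Core z → Core z' := by
    intro z z' hzz' ⟨l, hl⟩
    exact ⟨l, fun i k hw => (hzz' i k hw.1 hw.2) ▸ hl i k hw⟩
  have hdatum : Core (datumState (0 : Fin 2) X₀) := by
    refine ⟨l₀, fun i k hw => ?_⟩
    simp only [checkDatumBox, List.all_eq_true, List.mem_finRange, List.mem_range, decide_eq_true_eq, true_implies] at hdat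
    have hcc : (k + Kb).toNat < winLen Kb Ka := by unfold winLen; rw [Int.toNat_lt_toNat (by omega)]; omega
    have h1 := hdat i (k + Kb).toNat hcc
    rw [Int.toNat_of_nonneg (by omega), show k + Kb - Kb = k by ring] at h1
    have h1r := (Rat.cast_le (K := ℝ)).mpr h1
    simp only [Rat.cast_abs, Rat.cast_sub, Rat.cast_div, Rat.cast_mul, cast_dyadToRat] at h1r
    rw [idxOf_val i hw]
    simp only [datumState, hX₀def]
    rcases eq_or_ne k 0 with hk0 | hk0
    · simp only [hk0, if_true] at h1r ⊢; exact h1r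
    · simp only [if_neg hk0] at h1r ⊢; push_cast at h1r; exact h1r
  have hcoreL : ∀ (l : Fin L) (z : Fin 2 → ℤ → ℝ), InCoreBox Kb Ka (Cs l) (cen l) (chw l) z → Core z :=
    fun l z hz => ⟨l, fun i k hw => hz.2 i k hw⟩
  have hcoreTop : ∀ z, Core z → ∀ i, 4 * ((wq Ka : ℝ) * |z i Ka|) ≤ (rq : ℝ) := by
    intro z ⟨l, hl⟩ i
    have hS : ∀ i k, -Kb ≤ k → k ≤ Ka → (wq k : ℝ) * |z i k - z i k| ≤ (rq : ℝ) := fun i k _ _ => by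
      rw [sub_self, abs_zero, mul_zero]; exact_mod_cast hr.le
    exact (refBox_consequences (hω (start l)) hKb hKa1 (hrefs l) hl hS).2.2 i
  have hinside : ∀ (z S₀ : Fin 2 → ℤ → ℝ), Core z →
      (∀ i k, -Kb ≤ k → k ≤ Ka → (wq k : ℝ) * |S₀ i k - z i k| ≤ (rq : ℝ)) → ∀ i k, -Kb ≤ k → k ≤ Ka → |S₀ i k| < (Mq k : ℝ) :=
    fun z S₀ ⟨l, hl⟩ hS => (refBox_consequences (hω (start l)) hKb hKa1 (hrefs l) hl hS).1
  have hcover : ∀ (z S₀ : Fin 2 → ℤ → ℝ), Core z → (∀ i k, -Kb ≤ k → k ≤ Ka → (wq k : ℝ) * |S₀ i k - z i k| ≤ (rq : ℝ)) →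
      ∃ bb, ∀ d, |pxcoord Kb Ka (fun i k => (ωq bb i k : ℝ)) S₀ d - dvec (n := 2 * winLen Kb Ka) (rec bb 0).x d| ≤
        dvec (n := 2 * winLen Kb Ka) (rec bb 0).r d :=
    fun z S₀ ⟨l, hl⟩ hS => ⟨start l, (refBox_consequences (hω (start l)) hKb hKa1 (hrefs l) hl hS).2.1⟩
  -- the two dynamic clauses from the chain checkers
  have htrap0 := htrap_of_stepFactsP (Core := Core) (w := fun k => (wq k : ℝ)) (r := (rq : ℝ)) shiftsFlat_nodup hω
    (c := cq) (Mq := Mq) hs htr hcN hid hE hcover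
  have hland0 := hland_of_stepFactsL (Core := Core) (wq := wq) (r := rq) hKb hKa1 shiftsFlat_nodup h𝕊 hq hω hcoef (lev := lev) (c₀ := c₀q)
    (Mq := Mq) (i₀ := (0 : Fin 2)) (σ := σq) (ρ := ρq) (Zx := Zx) (θn := θn) (θd := θd)
    (Cs := fun bb j => Cs (tgt bb j)) (ell := ell) (cen := fun bb j => cen (tgt bb j)) (chw := fun bb j => chw (tgt bb j))
    hg hj (fun bb j hjb => hs bb j (by have := hjN bb; omega)) hsec hread (fun bb j _ _ z hz => hcoreL (tgt bb j) z hz) hbefore hafter hpos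
    hc₀N hid hE hcover
  rw [shiftsFlat_toFinset, cast_mirrorTableQ_half, hqe] at htrap0 hland0
  refine stub_rung_quarter_of_checks hX₀ hKb hKa hr hρ hρ1 hθ₀ hθ₀θ hθ hc₀ hc₀c hσ hMmax hcore hdatum hCw hb hwp hwn hCb hγ0 hγ1 hZb hZf
    hMZf checkB₁ checkB₂ hcoreTop hνKa hνhi hν₀ hν₁ hMν checkA₁ checkA₂ checkA₃ checkA₄ checkA₅ checkA₆ hinside ?_ ?_
  · intro s z S hz hs0 hsc hS0 hd hcb hct hbb hbt hMb
    exact htrap0 s z S hz hs0 hsc hS0 hd hcb hct (fun i u hu => (hbb i u hu).trans hEb) (fun i u hu => (hbt i u hu).trans hEt) hMb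
  · intro z S hz hS0 hd hcb hct hbb hbt hMb
    obtain ⟨τ₁, a', z', h1, h2, h3, h4, h5, h6, h7, h8, h9⟩ :=
      hland0 z S hz hS0 hd hcb hct (fun i u hu => (hbb i u hu).trans hEb) (fun i u hu => (hbt i u hu).trans hEt) hMb
    exact ⟨τ₁, a', z', h1, h2, h3, h4, h5, h6, h7, fun i v hv => h8 i v (hv.trans hEt),
      fun i => (h9 i).trans (mul_le_mul_of_nonneg_left hZx h3.le)⟩


/-! ### The E3 specialisation -/

/-- **THE REGISTERED STUB `stub_rung_quarter` FROM A CHECKED CERTIFICATE — E3 CONSTANTS, BOOLEANS ONLY**: glue XXXVI-c `stub_rung_quarter_of_certificateLJ`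
with every real-number hypothesis discharged for theory-1's E3 v0 constants (module docstring). Remaining inputs: the a-priori table `Mq` with three rational
facts, and the certificate's Booleans (per-branch gauges, READOUT-L, box-family core).
[cite: Tao2016AveragedNS, §6.3–6.4 Props. 6.4–6.5 (statement shape of a renormalisation certificate); route TaoLadderRungTwoFlat, crux K_A♭, stub_rung_quarter, certificate format E3] -/
theorem stub_rung_quarter_of_certificateE3S
    -- the a-priori box (glue gauge) and its three rational facts
    {Mq : ℤ → ℚ} (hMmax : ∀ k, -36 ≤ k → k ≤ 12 → Mq k ≤ 404) (hM36 : Mq (-36) ≤ 777) (hM12 : Mq 12 ≤ 401 / 1000000000000000000000000000)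
    -- THE CERTIFICATE: per-branch gauges and tables, branch chains, section records, READOUT-L data, the box family
    {ι : Type*} {ωq : ι → Fin 2 → ℤ → ℚ} (hω : ∀ bb i k, 0 < ωq bb i k)
    {cB : ι → Fin 2 → ℤ → Fin 2 → Fin 2 → ℤ × ℤ × ℤ → IntervalD}
    (hcoef : ∀ bb, CoefBoxOK shiftsFlat (((1 / 4 : ℚ)) : ℝ) (fun i₁ i₂ i μ => ((mirrorTableQ (1 / 2) (1 / 2) i₁ i₂ i μ : ℚ) : ℝ)) 36 12
      (fun i k => (ωq bb i k : ℝ)) (cB bb))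
    {prec : ι → ℕ} {Sp Sm : ι → IntervalD} {bD : ι → Dyad} {qz : ι → Array ℤ} {lev : ι → ℚ}
    {rec : ι → ℕ → VRec} {N j₁ j₂ : ι → ℕ} {sr : ι → ℕ → SecRec} {ell : ι → ℕ → Array Dyad}
    {L : ℕ} {Cs : Fin L → ℚ} {cen chw : Fin L → Array Dyad} {start : Fin L → ι} {tgt : ι → ℕ → Fin L} {l₀ : Fin L}
    (hg : ∀ bb, checkGlobalG 2 36 12 (prec bb) shiftsFlat (cB bb) (1 / 4) (Sp bb) (Sm bb) (bD bb) = true)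
    (hs : ∀ bb j, j < N bb →
      StepFacts shiftsFlat (1 / 4) (mirrorTableQ (1 / 2) (1 / 2)) 36 12 (prec bb) (cB bb) (ωq bb) (Sp bb) (Sm bb) EbE3 EtE3 (fun k => (Mq k : ℝ)) (rec bb) j)
    (htr : ∀ bb j, j < N bb → checkTransit 2 36 12 (ωq bb) Mq (rec bb j).lo (rec bb j).hi = true)
    (hcN : ∀ bb, (91 / 100 : ℚ) ≤ sumHV (rec bb) (N bb))
    (hj : ∀ bb, j₁ bb ≤ j₂ bb) (hjN : ∀ bb, j₂ bb < N bb)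
    (hsec : ∀ bb j, j₁ bb ≤ j → j ≤ j₂ bb →
      checkSection 2 36 12 (prec bb) shiftsFlat (cB bb) (qz bb) (rec bb j).lo (rec bb j).hi (rec bb j).δ (sr bb j) = true)
    (hread : ∀ bb j, j₁ bb ≤ j → j ≤ j₂ bb →
      checkReadoutL 2 36 12 (ωq bb) 0 (1 / 4) (1 / 4) (1 / 2) (1 / 1000000) ZxE3 EtE3 3 10 (pgaussW 1) (Cs (tgt bb j)) (ell bb j) (cen (tgt bb j)) (chw (tgt bb j))
        (xsArr (2 * winLen 36 12) (qz bb) (sr bb j) (rec bb j).x (lev bb)) (csArr (2 * winLen 36 12) (qz bb) (sr bb j) (rec bb j).C) (rec bb j).r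
        (esArr (2 * winLen 36 12) (qz bb) (sr bb j) (rec bb j).E (rec bb j).h) = true)
    (hbefore : ∀ bb, checkSecBelow (2 * winLen 36 12) (qz bb) (rec bb (j₁ bb)) (lev bb) = true)
    (hafter : ∀ bb, checkSecAbove (2 * winLen 36 12) (qz bb) (rec bb (j₂ bb + 1)) (lev bb) = true)
    (hpos : ∀ bb, 0 < sumHV (rec bb) (j₁ bb)) (hc₀N : ∀ bb, sumHV (rec bb) (j₂ bb + 1) ≤ (9 / 10 : ℚ))
    (hid : ∀ bb, checkIdFrame (2 * winLen 36 12) (rec bb 0).C = true) (hE : ∀ bb, checkNonneg (2 * winLen 36 12) (rec bb 0).E = true)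
    (hrefs : ∀ l, checkRefBox 36 12 (ωq (start l)) (pgaussW 1) Mq (1 / 1000000) (Cs l) (cen l) (chw l) (rec (start l) 0).x (rec (start l) 0).r = true)
    (hdat : checkDatumBox 36 12 x0E3 (Cs l₀) (cen l₀) (chw l₀) = true) :
    ∃ (σ : ℝ) (X₀ : Fin 2 → ℝ) (Z : Set (Fin 2 → ℤ → ℝ)) (w : ℤ → ℝ) (r ρ θ₀ θ c₀ c : ℝ) (env₀ : ℤ → ℝ),
      X₀ 0 ≠ 0 ∧
        GapData₂On shiftSetFlat σ (1 / 4) (0 : Fin 2) (mirrorTable (1 / 2) (1 / 2)) X₀ Z w r ρ θ₀ θ c₀ c env₀ ∧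
          TailThin (1 / 4) w r ∧
            ∃ (Cw b : ℝ), 1 ≤ Cw ∧ 1 / 2 ≤ b ∧ ∀ k : ℤ, 0 ≤ k → w k = Cw * (2 : ℝ) ^ ((k : ℝ) ^ 2 / 2 + b * k) := by
  -- the specialisation
  exact stub_rung_quarter_of_certificateLS (Kb := 36) (Ka := 12) (hKb := by norm_num) (hKa := by norm_num) (x0q := x0E3) (hx0 := by simp [x0E3])
    (M := fun k => (Mq k : ℝ)) (w := fun k => ((pgaussW 1 k : ℚ) : ℝ)) (Mq := Mq) (wq := pgaussW 1) (hM := fun _ => rfl) (hwq := fun _ => rfl)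
    (r := ((1 / 1000000 : ℚ) : ℝ)) (ρ := ((1 / 2 : ℚ) : ℝ)) (θ₀ := ((3 : ℕ) : ℝ) / ((10 : ℕ) : ℝ)) (θ := 1 / 2) (c₀ := ((9 / 10 : ℚ) : ℝ))
    (c := ((91 / 100 : ℚ) : ℝ)) (σ := ((1 / 4 : ℚ) : ℝ)) (rq := 1 / 1000000) (ρq := 1 / 2) (c₀q := 9 / 10) (cq := 91 / 100) (σq := 1 / 4)
    (θn := 3) (θd := 10) (hrq := rfl) (hρq := rfl) (hθ₀q := rfl) (hc₀q := rfl) (hcq := rfl) (hσq := rfl)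
    (hr := by norm_num) (hρ := by norm_num) (hρ1 := by norm_num) (hθ₀ := by norm_num) (hθ₀θ := by norm_num) (hθ := by norm_num)
    (hc₀ := by norm_num) (hc₀c := by norm_num) (hσ := by norm_num)
    (Mmax := 404) (hMmax := fun k hk1 hk2 => by exact_mod_cast hMmax k hk1 hk2)
    (Cw := 1) (b := 1 / 2) (hCw := le_rfl) (hb := le_rfl)
    (hwp := fun k hk => by rw [pgaussW_of_nonneg 1 hk]; push_cast; ring_nf)
    (hwn := fun k hk => by rw [pgaussW_of_neg 1 hk]; push_cast; ring_nf)
    (Zb := ZbE3) (Zf := ZfE3) (Cb := 7) (γ := 1 / 2) (hCb := by norm_num) (hγ0 := by norm_num) (hγ1 := by norm_num)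
    (hZb := fun j => rfl) (hZf := fun j => rfl) (hMZf := E3_hMZf hM36) (checkB₁ := E3_checkB1) (checkB₂ := E3_checkB2)
    (ν := nuE3) (ν₀ := nu0E3) (ν₁ := nu1E3) (ϑ := varthetaE3) (hνKa := by simp [nuE3]) (hνhi := fun K hK => by simp [nuE3, show ¬K ≤ 12 by omega])
    (hν₀ := by norm_num [nu0E3]) (hν₁ := by norm_num [nu1E3]) (hMν := E3_hMnu hM12)
    (checkA₁ := E3_checkA1) (checkA₂ := E3_checkA2) (checkA₃ := E3_checkA3) (checkA₄ := E3_checkA4) (checkA₅ := E3_checkA5) (checkA₆ := E3_checkA6)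
    (Eb := EbE3) (Et := EtE3) (Zx := ZxE3) (hEb := E3_hEb) (hEt := E3_hEt) (hZx := E3_hZx)
    (hω := hω) (hcoef := hcoef) (hg := hg) (hs := hs) (htr := htr) (hcN := hcN) (hj := hj) (hjN := hjN) (hsec := hsec) (hread := hread)
    (hbefore := hbefore) (hafter := hafter) (hpos := hpos) (hc₀N := hc₀N) (hid := hid) (hE := hE) (hrefs := hrefs) (hdat := hdat)


end CertificateGlueOn



end Summit.NavierStokesRegularity.NavierStokesRegularity.Theorems

end
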